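import Mathlib.Analysis.SpecialFunctions.Trigonometric.ArctanDeriv
import Mathlib.Analysis.SpecialFunctions.Log.Deriv
import Mathlib.Analysis.SpecialFunctions.Sqrt
import Mathlib.Analysis.SpecialFunctions.Pow.Asymptotics
import Mathlib.Analysis.Calculus.Deriv.MeanValue
import HarnessLib

/-!
# ArgmaxIncrementProfile — door S36-K «IncrementDoor» (nsreg-p1 ROUND-34 §B), plate P «ModulusProfileExists»:
# an explicit admissible Kiselev–Nazarov–Volberg modulus profile

S-door lane (ns-sfl-p1 g5; LEAD ns-s30-p1 g3; texts of record nsreg-p1 g30 `r34/Sketch36.lean` sha16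
f0fe6d26e287c4b8, `IsModulusProfile` l.707, `ModulusProfileExists` l.832; `--supports stmt-NavierStokesRegularity-0056
--as helper`). Pure real analysis: the profile

  `Θ(ρ) = log(1 + √ρ + ρ) − (2/√3)·arctan((2√ρ + 1)/√3) + (2/√3)·arctan(1/√3)`,
  `Θ'(ρ) = 1/(1 + √ρ + ρ)`, `Θ''(ρ) = −(1/(2√ρ) + 1)/(1 + √ρ + ρ)²`

satisfies every clause of `IsModulusProfile`: `Θ(0) = 0`, continuity at `0⁺`, `Θ'`/`Θ''` are the first/second
derivatives on `(0,∞)`, `0 < Θ' ≤ 1`, `Θ'' < 0`, `Θ''(0⁺) = −∞` (the `−1/(2√ρ)` term), `0 ≤ Θ(ρ) ≤ ρ`, `Θ > 0` on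
`(0,∞)` and `Θ → ∞` (`Θ ≥ log ρ − π/√3`): UNBOUNDED and infinitely concave at the origin, as the two-point
(KNV) breakthrough argument requires. `modulusProfileExists` is the text of plate P δ-unfolded (the by-name
`modulusProfileExists_holds : ModulusProfileExists` follows by `exact` once P0-36 is in the tree).

WHAT THIS IS NOT: a calculus witness making a regularity CRITERION (door S36-K) non-vacuous; item 0056 `NoTypeII`
and NS regularity are NOT proved; nothing here is a route or a summit statement.
-/

-- the summit's problem namespace repeats the summit name (tree layout)
set_option linter.dupNamespace false

noncomputable section

open Set Filter Real
open scoped Topology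

namespace Summit.NavierStokesRegularity.NavierStokesRegularity.Theorems.IncrementDoors

/-! ### Derivatives of the three pieces -/

/-- `1 + √ρ + ρ ≥ 1` for `ρ ≥ 0`. -/
theorem one_le_one_add_sqrt_add {ρ : ℝ} (hρ : 0 ≤ ρ) : 1 ≤ 1 + Real.sqrt ρ + ρ := by
  have := Real.sqrt_nonneg ρ
  linarith

/-- `d/dρ (1 + √ρ + ρ) = 1/(2√ρ) + 1` for `ρ > 0`. -/
theorem hasDerivAt_one_add_sqrt_add {ρ : ℝ} (hρ : 0 < ρ) :
    HasDerivAt (fun r => 1 + Real.sqrt r + r) (1 / (2 * Real.sqrt ρ) + 1) ρ := by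
  exact ((Real.hasDerivAt_sqrt hρ.ne').const_add 1).add (hasDerivAt_id' ρ)

/-- `d/dρ log(1 + √ρ + ρ) = (1/(2√ρ) + 1)/(1 + √ρ + ρ)` for `ρ > 0`. -/
theorem hasDerivAt_log_piece {ρ : ℝ} (hρ : 0 < ρ) :
    HasDerivAt (fun r => Real.log (1 + Real.sqrt r + r))
      ((1 / (2 * Real.sqrt ρ) + 1) / (1 + Real.sqrt ρ + ρ)) ρ := by
  have hpos : 0 < 1 + Real.sqrt ρ + ρ := lt_of_lt_of_le one_pos (one_le_one_add_sqrt_add hρ.le)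
  have h := (hasDerivAt_one_add_sqrt_add hρ).log hpos.ne'
  simpa using h

/-- `d/dρ [(2/√3)·arctan((2√ρ+1)/√3)] = 1/(2√ρ(1 + √ρ + ρ))` for `ρ > 0`. -/
theorem hasDerivAt_arctan_piece {ρ : ℝ} (hρ : 0 < ρ) :
    HasDerivAt (fun r => 2 / Real.sqrt 3 * Real.arctan ((2 * Real.sqrt r + 1) / Real.sqrt 3))
      (1 / (2 * Real.sqrt ρ * (1 + Real.sqrt ρ + ρ))) ρ := by
  have hs : 0 < Real.sqrt ρ := Real.sqrt_pos.2 hρ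
  have ht : 0 < Real.sqrt 3 := Real.sqrt_pos.2 (by norm_num)
  have hs2 : Real.sqrt ρ ^ 2 = ρ := Real.sq_sqrt hρ.le
  have ht2 : Real.sqrt 3 ^ 2 = 3 := Real.sq_sqrt (by norm_num)
  -- inner function
  have h1 : HasDerivAt (fun r => (2 * Real.sqrt r + 1) / Real.sqrt 3)
      ((2 * (1 / (2 * Real.sqrt ρ))) / Real.sqrt 3) ρ := by
    have h := ((Real.hasDerivAt_sqrt hρ.ne').const_mul 2).add_const 1
    exact h.div_const (Real.sqrt 3)
  have h2 := (h1.arctan).const_mul (2 / Real.sqrt 3)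
  refine h2.congr_deriv ?_
  field_simp
  rw [ht2]
  linear_combination (-4 : ℝ) * hs2

/-- **`Θ' = 1/(1 + √ρ + ρ)` is the derivative of `Θ`** on `(0,∞)`. -/
theorem hasDerivAt_profile {ρ : ℝ} (hρ : 0 < ρ) :
    HasDerivAt (fun r => Real.log (1 + Real.sqrt r + r) -
        2 / Real.sqrt 3 * Real.arctan ((2 * Real.sqrt r + 1) / Real.sqrt 3) +
        2 / Real.sqrt 3 * Real.arctan (1 / Real.sqrt 3))
      (1 / (1 + Real.sqrt ρ + ρ)) ρ := by
  have hs : 0 < Real.sqrt ρ := Real.sqrt_pos.2 hρ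
  have hpos : 0 < 1 + Real.sqrt ρ + ρ := lt_of_lt_of_le one_pos (one_le_one_add_sqrt_add hρ.le)
  have h := ((hasDerivAt_log_piece hρ).sub (hasDerivAt_arctan_piece hρ)).add_const
    (2 / Real.sqrt 3 * Real.arctan (1 / Real.sqrt 3))
  refine h.congr_deriv ?_
  field_simp
  ring

/-- **`Θ'' = −(1/(2√ρ) + 1)/(1 + √ρ + ρ)²` is the derivative of `Θ'`** on `(0,∞)`. -/
theorem hasDerivAt_profileD {ρ : ℝ} (hρ : 0 < ρ) :
    HasDerivAt (fun r => 1 / (1 + Real.sqrt r + r))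
      (-((1 / (2 * Real.sqrt ρ) + 1) / (1 + Real.sqrt ρ + ρ) ^ 2)) ρ := by
  have hpos : 0 < 1 + Real.sqrt ρ + ρ := lt_of_lt_of_le one_pos (one_le_one_add_sqrt_add hρ.le)
  have h := (hasDerivAt_one_add_sqrt_add hρ).inv hpos.ne'
  have heq : (fun r => 1 / (1 + Real.sqrt r + r)) = fun r => (1 + Real.sqrt r + r)⁻¹ := by
    funext r; rw [one_div]
  rw [heq]
  refine h.congr_deriv ?_
  rw [neg_div]

/-! ### The profile is continuous on `[0,∞)` -/

/-- `Θ` is continuous on `[0,∞)`. -/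
theorem continuousOn_profile :
    ContinuousOn (fun r => Real.log (1 + Real.sqrt r + r) -
        2 / Real.sqrt 3 * Real.arctan ((2 * Real.sqrt r + 1) / Real.sqrt 3) +
        2 / Real.sqrt 3 * Real.arctan (1 / Real.sqrt 3)) (Ici 0) := by
  refine ContinuousOn.add (ContinuousOn.sub ?_ ?_) continuousOn_const
  · refine ContinuousOn.log ((continuousOn_const.add Real.continuous_sqrt.continuousOn).add
      continuousOn_id) fun r hr => ?_
    exact (lt_of_lt_of_le one_pos (one_le_one_add_sqrt_add hr)).ne'
  · exact (continuousOn_const.mul ((continuous_arctan.comp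
      (((continuous_const.mul Real.continuous_sqrt).add continuous_const).div_const _)).continuousOn))

/-! ### Plate P «ModulusProfileExists» -/

/-- plate P «ModulusProfileExists» (nsreg-p1 ROUND-34 §B, `Sketch36.lean` l.832), PROVED — the text δ-unfolded
(`IsModulusProfile` l.707 spelled out): there is an admissible modulus profile. Witness:
`Θ(ρ) = log(1+√ρ+ρ) − (2/√3)(arctan((2√ρ+1)/√3) − arctan(1/√3))`, `Θ' = 1/(1+√ρ+ρ)`,
`Θ'' = −(1/(2√ρ)+1)/(1+√ρ+ρ)²`. -/
theorem modulusProfileExists : ∃ Θ Θ' Θ'' : ℝ → ℝ,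
    Θ 0 = 0 ∧ ContinuousWithinAt Θ (Ici 0) 0 ∧
    (∀ ρ : ℝ, 0 < ρ → HasDerivAt Θ (Θ' ρ) ρ ∧ HasDerivAt Θ' (Θ'' ρ) ρ) ∧
    (∀ ρ : ℝ, 0 < ρ → 0 < Θ ρ ∧ 0 < Θ' ρ ∧ Θ' ρ ≤ 1 ∧ Θ'' ρ < 0) ∧
    Tendsto Θ'' (𝓝[>] 0) atBot ∧
    (∀ ρ : ℝ, 0 ≤ ρ → 0 ≤ Θ ρ ∧ Θ ρ ≤ ρ) ∧
    Tendsto Θ atTop atTop := by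
  refine ⟨fun r => Real.log (1 + Real.sqrt r + r) -
      2 / Real.sqrt 3 * Real.arctan ((2 * Real.sqrt r + 1) / Real.sqrt 3) +
      2 / Real.sqrt 3 * Real.arctan (1 / Real.sqrt 3),
    fun r => 1 / (1 + Real.sqrt r + r),
    fun r => -((1 / (2 * Real.sqrt r) + 1) / (1 + Real.sqrt r + r) ^ 2), ?_, ?_, ?_, ?_, ?_, ?_, ?_⟩
  -- `Θ(0) = 0`
  · simp
  -- continuity at `0⁺`
  · exact continuousOn_profile.continuousWithinAt (self_mem_Ici)
  -- the derivatives on `(0,∞)`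
  · exact fun ρ hρ => ⟨hasDerivAt_profile hρ, hasDerivAt_profileD hρ⟩
  -- signs on `(0,∞)`
  · intro ρ hρ
    have hs : 0 < Real.sqrt ρ := Real.sqrt_pos.2 hρ
    have h1 : 1 ≤ 1 + Real.sqrt ρ + ρ := one_le_one_add_sqrt_add hρ.le
    have hpos : 0 < 1 + Real.sqrt ρ + ρ := lt_of_lt_of_le one_pos h1
    refine ⟨?_, by positivity, (div_le_one hpos).2 h1, ?_⟩
    · -- `Θ(ρ) > Θ(0) = 0` by strict monotonicity (`Θ' > 0` on the interior)
      have hmono : StrictMonoOn (fun r => Real.log (1 + Real.sqrt r + r) -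
          2 / Real.sqrt 3 * Real.arctan ((2 * Real.sqrt r + 1) / Real.sqrt 3) +
          2 / Real.sqrt 3 * Real.arctan (1 / Real.sqrt 3)) (Ici 0) := by
        refine strictMonoOn_of_deriv_pos (convex_Ici 0) continuousOn_profile fun r hr => ?_
        rw [interior_Ici] at hr
        rw [(hasDerivAt_profile hr).deriv]
        have := one_le_one_add_sqrt_add (le_of_lt hr)
        positivity
      have h0 := hmono (self_mem_Ici) (hρ.le : (0 : ℝ) ≤ ρ) hρ
      simpa using h0
    · have : 0 < (1 / (2 * Real.sqrt ρ) + 1) / (1 + Real.sqrt ρ + ρ) ^ 2 := by positivity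
      linarith
  -- `Θ''(0⁺) = −∞`
  · -- on `(0,1)`: `Θ''(ρ) ≤ −(1/18)·ρ^{-1/2}`
    have hcmp : ∀ᶠ ρ in 𝓝[>] (0 : ℝ),
        -((1 / (2 * Real.sqrt ρ) + 1) / (1 + Real.sqrt ρ + ρ) ^ 2) ≤ -(1 / 18 * ρ ^ (-(1 / 2 : ℝ))) := by
      have hmem : Ioo (0 : ℝ) 1 ∈ 𝓝[>] (0 : ℝ) := Ioo_mem_nhdsGT one_pos
      filter_upwards [hmem] with ρ hρ
      have hs : 0 < Real.sqrt ρ := Real.sqrt_pos.2 hρ.1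
      have hs1 : Real.sqrt ρ ≤ 1 := by
        rw [show (1 : ℝ) = Real.sqrt 1 by simp]
        exact Real.sqrt_le_sqrt hρ.2.le
      have hρ0 : 0 < ρ := hρ.1
      have h3 : 1 + Real.sqrt ρ + ρ ≤ 3 := by linarith [hρ.2]
      have h3' : 0 ≤ 1 + Real.sqrt ρ + ρ := by positivity
      have hden : (1 + Real.sqrt ρ + ρ) ^ 2 ≤ 9 := by
        have := pow_le_pow_left₀ h3' h3 2
        norm_num at this
        exact this
      have hdenpos : 0 < (1 + Real.sqrt ρ + ρ) ^ 2 := by positivity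
      have hrpow : ρ ^ (-(1 / 2 : ℝ)) = (Real.sqrt ρ)⁻¹ := by
        rw [Real.rpow_neg hρ.1.le, ← Real.sqrt_eq_rpow]
      rw [hrpow, neg_le_neg_iff]
      -- `(1/18)/√ρ ≤ (1/(2√ρ) + 1)/(1+√ρ+ρ)²`
      have hlow : 1 / (2 * Real.sqrt ρ) / 9 ≤ (1 / (2 * Real.sqrt ρ) + 1) / (1 + Real.sqrt ρ + ρ) ^ 2 := by
        have ha : 1 / (2 * Real.sqrt ρ) ≤ 1 / (2 * Real.sqrt ρ) + 1 := by linarith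
        have hb : 0 ≤ 1 / (2 * Real.sqrt ρ) := by positivity
        calc 1 / (2 * Real.sqrt ρ) / 9 ≤ 1 / (2 * Real.sqrt ρ) / (1 + Real.sqrt ρ + ρ) ^ 2 :=
              div_le_div_of_nonneg_left hb hdenpos hden
          _ ≤ (1 / (2 * Real.sqrt ρ) + 1) / (1 + Real.sqrt ρ + ρ) ^ 2 :=
              div_le_div_of_nonneg_right ha hdenpos.le
      have heq : 1 / 18 * (Real.sqrt ρ)⁻¹ = 1 / (2 * Real.sqrt ρ) / 9 := by
        field_simp; ring
      rw [heq]
      exact hlow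
    have hbot : Tendsto (fun ρ : ℝ => -(1 / 18 * ρ ^ (-(1 / 2 : ℝ)))) (𝓝[>] 0) atBot := by
      have h1 : Tendsto (fun ρ : ℝ => ρ ^ (-(1 / 2 : ℝ))) (𝓝[>] 0) atTop :=
        tendsto_rpow_neg_nhdsGT_zero (by norm_num : (-(1 / 2 : ℝ)) < 0)
      have h2 : Tendsto (fun ρ : ℝ => 1 / 18 * ρ ^ (-(1 / 2 : ℝ))) (𝓝[>] 0) atTop :=
        h1.const_mul_atTop (by norm_num)
      exact tendsto_neg_atTop_atBot.comp h2
    exact tendsto_atBot_mono' _ hcmp hbot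
  -- `0 ≤ Θ(ρ) ≤ ρ` on `[0,∞)`
  · intro ρ hρ
    have hmonoΘ : MonotoneOn (fun r => Real.log (1 + Real.sqrt r + r) -
        2 / Real.sqrt 3 * Real.arctan ((2 * Real.sqrt r + 1) / Real.sqrt 3) +
        2 / Real.sqrt 3 * Real.arctan (1 / Real.sqrt 3)) (Ici 0) := by
      refine monotoneOn_of_deriv_nonneg (convex_Ici 0) continuousOn_profile ?_ fun r hr => ?_
      · intro r hr
        rw [interior_Ici] at hr
        exact (hasDerivAt_profile hr).differentiableAt.differentiableWithinAt
      · rw [interior_Ici] at hr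
        rw [(hasDerivAt_profile hr).deriv]
        have := one_le_one_add_sqrt_add (le_of_lt hr)
        positivity
    have hmonoG : MonotoneOn (fun r => r - (Real.log (1 + Real.sqrt r + r) -
        2 / Real.sqrt 3 * Real.arctan ((2 * Real.sqrt r + 1) / Real.sqrt 3) +
        2 / Real.sqrt 3 * Real.arctan (1 / Real.sqrt 3))) (Ici 0) := by
      refine monotoneOn_of_deriv_nonneg (convex_Ici 0) (continuousOn_id.sub continuousOn_profile) ?_
        fun r hr => ?_
      · intro r hr
        rw [interior_Ici] at hr
        exact ((hasDerivAt_id' r).sub (hasDerivAt_profile hr)).differentiableAt.differentiableWithinAt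
      · rw [interior_Ici] at hr
        have hd : HasDerivAt (fun r => r - (Real.log (1 + Real.sqrt r + r) -
            2 / Real.sqrt 3 * Real.arctan ((2 * Real.sqrt r + 1) / Real.sqrt 3) +
            2 / Real.sqrt 3 * Real.arctan (1 / Real.sqrt 3))) (1 - 1 / (1 + Real.sqrt r + r)) r :=
          (hasDerivAt_id' r).sub (hasDerivAt_profile hr)
        rw [hd.deriv]
        have h1 : 1 ≤ 1 + Real.sqrt r + r := one_le_one_add_sqrt_add (le_of_lt hr)
        have hpos : 0 < 1 + Real.sqrt r + r := lt_of_lt_of_le one_pos h1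
        have : 1 / (1 + Real.sqrt r + r) ≤ 1 := (div_le_one hpos).2 h1
        linarith
    have h0 := hmonoΘ (self_mem_Ici) hρ hρ
    have h1 := hmonoG (self_mem_Ici) hρ hρ
    have h00 : Real.log (1 + Real.sqrt 0 + 0) -
        2 / Real.sqrt 3 * Real.arctan ((2 * Real.sqrt 0 + 1) / Real.sqrt 3) +
        2 / Real.sqrt 3 * Real.arctan (1 / Real.sqrt 3) = 0 := by simp
    have h0' : Real.log (1 + Real.sqrt 0 + 0) -
        2 / Real.sqrt 3 * Real.arctan ((2 * Real.sqrt 0 + 1) / Real.sqrt 3) +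
        2 / Real.sqrt 3 * Real.arctan (1 / Real.sqrt 3) ≤
        Real.log (1 + Real.sqrt ρ + ρ) -
        2 / Real.sqrt 3 * Real.arctan ((2 * Real.sqrt ρ + 1) / Real.sqrt 3) +
        2 / Real.sqrt 3 * Real.arctan (1 / Real.sqrt 3) := h0
    have h1' : (0 : ℝ) - (Real.log (1 + Real.sqrt 0 + 0) -
        2 / Real.sqrt 3 * Real.arctan ((2 * Real.sqrt 0 + 1) / Real.sqrt 3) +
        2 / Real.sqrt 3 * Real.arctan (1 / Real.sqrt 3)) ≤ ρ - (Real.log (1 + Real.sqrt ρ + ρ) -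
        2 / Real.sqrt 3 * Real.arctan ((2 * Real.sqrt ρ + 1) / Real.sqrt 3) +
        2 / Real.sqrt 3 * Real.arctan (1 / Real.sqrt 3)) := h1
    rw [h00] at h0' h1'
    constructor
    · exact h0'
    · linarith
  -- `Θ → ∞`
  · have hlow : ∀ᶠ ρ in atTop, Real.log ρ + (-(2 / Real.sqrt 3 * (π / 2)) +
        2 / Real.sqrt 3 * Real.arctan (1 / Real.sqrt 3)) ≤
        Real.log (1 + Real.sqrt ρ + ρ) -
          2 / Real.sqrt 3 * Real.arctan ((2 * Real.sqrt ρ + 1) / Real.sqrt 3) +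
          2 / Real.sqrt 3 * Real.arctan (1 / Real.sqrt 3) := by
      filter_upwards [eventually_gt_atTop (0 : ℝ)] with ρ hρ
      have ht : 0 < 2 / Real.sqrt 3 := div_pos two_pos (Real.sqrt_pos.2 (by norm_num))
      have h1 : Real.log ρ ≤ Real.log (1 + Real.sqrt ρ + ρ) :=
        Real.log_le_log hρ (by linarith [Real.sqrt_nonneg ρ])
      have h2 : 2 / Real.sqrt 3 * Real.arctan ((2 * Real.sqrt ρ + 1) / Real.sqrt 3) ≤
          2 / Real.sqrt 3 * (π / 2) :=
        mul_le_mul_of_nonneg_left (Real.arctan_lt_pi_div_two _).le ht.le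
      linarith
    refine tendsto_atTop_mono' _ hlow ?_
    exact tendsto_atTop_add_const_right _ _ Real.tendsto_log_atTop

end Summit.NavierStokesRegularity.NavierStokesRegularity.Theorems.IncrementDoors

end
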